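import Summits.HodgeConjecture.HodgeConjecture.Theorems.Ring2WeilCoverageTypeNormSignPrincipal
import Summits.HodgeConjecture.HodgeConjecture.Theorems.Ring2WeilCoverageCyclotomicSignaturesG12D
import Summits.HodgeConjecture.HodgeConjecture.Theorems.Ring2WeilCoverageCyclotomicUnconditionalSqrtFive
import Summits.HodgeConjecture.HodgeConjecture.Theorems.Ring2WeilCoverageCMTypeSetOddPositions
import HarnessLib

/-!
# Weil-type family coverage — THE NORM-SIGN LAW AT THE LEVELS 35, 45: on every census row `(ℚ(ζ_M), K)` the
# `ι`-compatible polarisation types `(ϖ₀)` carried by the `K`-balanced points `ℂ^Φ/Φ(ℤ[ζ_M])` are EXACTLY the real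
# generators `ϖ₀ ∈ 𝓞 ℚ(ζ_M)⁺` with `N(ϖ₀) < 0` (NO rows) resp. `N(ϖ₀) > 0` (YES rows)

research route conditional on HC_CM; not a corollary; Q11.4-sentence-2 already refuted in dim ≥ 3.

Ring 2, WEIL-TYPE FAMILY-COVERAGE CENSUS (`HOME/WEIL-FAMILY-COVERAGE.md` `## b01`, blocks b01.34–b01.41; owner ring2-b01),
part 56c of the `Ring2WeilCoverage*` series: the level files of part 55/55b (`…TypeNormSign`, `…TypeNormSignPrincipal`: for
any CM field, under THEOREM L (i)/(ii), «type `(ϖ₀)` occurs on `ℂ^Φ/D(𝔪)`» ⟺ («principal» ⟺ `N_{K⁺/ℚ}(ϖ₀) > 0`)).  At the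
levels `M ∈ {35, 45}` (`g = 12`) THEOREM L (i) (`norm_realUnits_pos_M`: every unit of `ℤ[ζ_M]⁺` has norm `+1`)
and THEOREM L (ii) (`exists_units_sign_eq_M`: every even sign pattern is a unit pattern) are hypothesis-free tree theorems
(parts 8/9/15/18/30/30′/31/48b/57), and the principal verdict of a `K`-balanced `Φ` is the residue bit `n₋(M, K) =
#{t ∈ N_K : 2t < M} (mod 2)` (part 5′ `card_inter_nodd_mod_two_eq`, THEOREM F).  Hence, for EVERY real `ϖ₀ ∈ 𝓞 K⁺ ∖ 0`
at once (no residue sign dictionary, unlike parts 48–54 which treated one generator per file):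

* NO rows (`(35, ℚ(√−7))`, `(35, ℚ(√−35))`, `(45, ℚ(√−3))`, `(45, ℚ(√−15))`): **type `(ϖ₀)` occurs ⟺ `N_{K⁺/ℚ}(ϖ₀) < 0`**;
* YES rows (none at these levels): **type `(ϖ₀)` occurs ⟺ `N_{K⁺/ℚ}(ϖ₀) > 0`**;
* every level, EVERY CM type `Φ`: `N(ϖ₀) < 0` ⇒ exactly one of «principal», «type `(ϖ₀)`»; `N(ϖ₀) > 0` ⇒ both or neither.

Since `h(ℚ(ζ_M)) = 1` at these levels [Was97 Thm. 11.1], `h(ℚ(ζ_M)⁺) = 1` and every type `𝔣₀ ⊆ 𝓞 K⁺` is principal, so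
these rows list ALL `ι`-compatible polarisation types of the `K`-balanced `ℤ[ζ_M]`-points (S-pencil remark; the kernel statements quantify over principal types `(ϖ₀)`).  The polarisation of type `(ϖ₀)` has degree `|N_{K⁺/ℚ}(ϖ₀)|`; by
b01.41 (C) (S-pencil) its hermitian discriminant class is `[−N_{K⁺/ℚ}(ϖ₀)]·[−1]^n…` — i.e. the component `(n, K, a)` with
`a ≡ |N(ϖ₀)|` on the NO rows.

Theorems:
* `exists_type_iff_norm_neg_thirtyFive_sqrt_neg_seven`
* `exists_type_iff_norm_neg_thirtyFive_sqrt_neg_thirtyFive`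
* `xor_principal_type_thirtyFive_of_norm_neg`
* `exists_type_iff_principal_thirtyFive_of_norm_pos`
* `exists_type_iff_norm_neg_fortyFive_sqrt_neg_three`
* `exists_type_iff_norm_neg_fortyFive_sqrt_neg_fifteen`
* `xor_principal_type_fortyFive_of_norm_neg`
* `exists_type_iff_principal_fortyFive_of_norm_pos`

HONEST FRAMING: torus-level statements about Shimura's divisors of type `(K; Φ; 𝔣₀)` [Sh98 §14.3 Prop. 4–5] on
`ℂ^Φ/Φ(ℤ[ζ_M])` and norms of elements of `ℚ(ζ_M)⁺`; nothing here is a statement about Hodge classes, `W_K`, general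
members or HC; `HC_CM` is used nowhere.  No `def`, no named fact, no `sorry`.

References: [cite: Shimura1998, §14.3 Prop. 4–5, pp. 103–104]; [cite: Washington1997, Thm. 11.1]; census b01.41 (seat-derived).
-/

noncomputable section

open Polynomial NumberField Complex Finset
open scoped Real nonZeroDivisors

namespace Summit.HodgeConjecture.Ring2WeilCoverage.TypeNormSignLevelsG12

open Literature.AlgebraicGeometry.Motives (CMType)
open Literature.AlgebraicGeometry.HodgeTheory (IsCMTypeSet)
open Literature.AlgebraicGeometry.ComplexMultiplication.CyclotomicCMType (isCMTypeSet_residueFilter)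
open Literature.NumberTheory.ComplexMultiplication
open Summit.HodgeConjecture.Ring2WeilCoverage.TypeNormSign
open Summit.HodgeConjecture.Ring2WeilCoverage.CyclotomicDifferent (xi_ne_zero isOfType_one_xi_top)
open Summit.HodgeConjecture.Ring2WeilCoverage.CyclotomicPrincipalObstruction (complexConj_xi)
open Summit.HodgeConjecture.Ring2WeilCoverage.CMTypeSetOddPositions (card_inter_nodd_mod_two_eq)
open Summit.HodgeConjecture.Ring2WeilCoverage.CyclotomicUnconditionalSqrtFive (norm_realUnits_pos_thirtyFive)
open Summit.HodgeConjecture.Ring2WeilCoverage.CyclotomicSignaturesG12D (exists_units_sign_eq_thirtyFive)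
open Summit.HodgeConjecture.Ring2WeilCoverage.CyclotomicUnconditionalSqrtFive (norm_realUnits_pos_fortyFive)
open Summit.HodgeConjecture.Ring2WeilCoverage.CyclotomicSignaturesG12D (exists_units_sign_eq_fortyFive)

variable {K : Type} [Field K] [NumberField K] {ζ : K}

/-- `𝐞(t) = exp(2πi t/n) ∈ ℂ` (`ZMod.toCircle`). -/
local notation3 (prettyPrint := false) "𝐞 " t:max => ((ZMod.toCircle t : Circle) : ℂ)

/-! ### Level `35` (`g = 24`) -/

section Level35

/-- the residue set `S_Φ` read at level `35`. -/
local notation3 (prettyPrint := false) "SΦ35[" Φ "," z "]" =>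
  (Finset.univ.filter fun t : ZMod 35 => ∃ σ ∈ (Φ : CMType K).1, σ (z : K) = 𝐞 t)

open scoped Classical in
/-- **CENSUS ROW `(ℚ(ζ_35), ℚ(√−7))` — THE TYPE SPECTRUM (a NO row: no `ι`-compatible principal polarisation).**  For
every CM type `Φ` of `ℚ(ζ_35)` balanced for `N_K = [3, 6, 12, 13, 17, 19, 24, 26, 27, 31, 33, 34]` (the Weil signature `(12,12)` on `K = ℚ(√−7)`) and EVERY real integer
`ϖ₀ ∈ 𝓞 K⁺ ∖ 0` (`K⁺ = ℚ(ζ_35)⁺`): the principal CM torus `ℂ^Φ/Φ(ℤ[ζ_35])` carries a `Φ`-positive divisor `X_ζ′` of type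
`(K; Φ; (ϖ₀))` — an `ι`-compatible polarisation whose `φ_X` is the `(ϖ₀)𝔬`-multiplication, of degree `|N_{K⁺/ℚ}(ϖ₀)|` —
**iff `N_{K⁺/ℚ}(ϖ₀) < 0`**.  No sign dictionary for `ϖ₀`: part 55b `exists_type_span_iff_norm_neg_of_odd` + THEOREM L (i)/(ii)
at `35` + `|S_Φ ∩ N_odd| ≡ n₋ = 5` (part 5′ `card_inter_nodd_mod_two_eq`).  The ramified type `𝔮_p` and the surd types of
parts 49–54 are the instances `N(π) = −p^{f}`.
research route conditional on HC_CM; not a corollary; Q11.4-sentence-2 already refuted in dim ≥ 3. [cite: Shimura1998, §14.3 Prop. 4–5, pp. 103–104] -/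
theorem exists_type_iff_norm_neg_thirtyFive_sqrt_neg_seven [IsCMField K] [IsCyclotomicExtension {35} ℚ K] (hζ : IsPrimitiveRoot ζ 35)
    (Φ : CMType K) (hbal : 2 * (SΦ35[Φ, ζ] ∩ ({3, 6, 12, 13, 17, 19, 24, 26, 27, 31, 33, 34} : Finset (ZMod 35))).card = (SΦ35[Φ, ζ]).card)
    {ϖ₀ : 𝓞 (maximalRealSubfield K)} (hϖ0 : ϖ₀ ≠ 0) :
    (∃ ζ' : K, IsCMField.complexConj K ζ' = -ζ' ∧ (∀ φ : Φ.1, 0 < (φ.1 ζ').im) ∧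
        CMTypeLattice.IsOfType (1 : (FractionalIdeal (𝓞 K)⁰ K)ˣ) ζ' (Ideal.span {ϖ₀})) ↔
      Algebra.norm ℚ ((ϖ₀ : maximalRealSubfield K)) < 0 := by
  have hg : Nat.totient 35 = 2 * (11 + 1) := by decide
  refine exists_type_span_iff_norm_neg_of_odd hζ hg Φ hϖ0 (norm_realUnits_pos_thirtyFive hζ) (exists_units_sign_eq_thirtyFive hζ Φ) ?_
  have hS := isCMTypeSet_residueFilter hζ Φ
  have hNK : IsCMTypeSet 35 ({3, 6, 12, 13, 17, 19, 24, 26, 27, 31, 33, 34} : Finset (ZMod 35)) := by decide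
  have h := card_inter_nodd_mod_two_eq (m := 35) (by norm_num) hS hNK hbal
  have hn : ((({3, 6, 12, 13, 17, 19, 24, 26, 27, 31, 33, 34} : Finset (ZMod 35))).filter fun t : ZMod 35 => 2 * t.val < 35).card % 2 = 1 := by
    decide
  rw [hn] at h
  exact Nat.odd_iff.mpr h

open scoped Classical in
/-- **CENSUS ROW `(ℚ(ζ_35), ℚ(√−35))` — THE TYPE SPECTRUM (a NO row: no `ι`-compatible principal polarisation).**  For
every CM type `Φ` of `ℚ(ζ_35)` balanced for `N_K = [2, 6, 8, 18, 19, 22, 23, 24, 26, 31, 32, 34]` (the Weil signature `(12,12)` on `K = ℚ(√−35)`) and EVERY real integer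
`ϖ₀ ∈ 𝓞 K⁺ ∖ 0` (`K⁺ = ℚ(ζ_35)⁺`): the principal CM torus `ℂ^Φ/Φ(ℤ[ζ_35])` carries a `Φ`-positive divisor `X_ζ′` of type
`(K; Φ; (ϖ₀))` — an `ι`-compatible polarisation whose `φ_X` is the `(ϖ₀)𝔬`-multiplication, of degree `|N_{K⁺/ℚ}(ϖ₀)|` —
**iff `N_{K⁺/ℚ}(ϖ₀) < 0`**.  No sign dictionary for `ϖ₀`: part 55b `exists_type_span_iff_norm_neg_of_odd` + THEOREM L (i)/(ii)
at `35` + `|S_Φ ∩ N_odd| ≡ n₋ = 3` (part 5′ `card_inter_nodd_mod_two_eq`).  The ramified type `𝔮_p` and the surd types of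
parts 49–54 are the instances `N(π) = −p^{f}`.
research route conditional on HC_CM; not a corollary; Q11.4-sentence-2 already refuted in dim ≥ 3. [cite: Shimura1998, §14.3 Prop. 4–5, pp. 103–104] -/
theorem exists_type_iff_norm_neg_thirtyFive_sqrt_neg_thirtyFive [IsCMField K] [IsCyclotomicExtension {35} ℚ K] (hζ : IsPrimitiveRoot ζ 35)
    (Φ : CMType K) (hbal : 2 * (SΦ35[Φ, ζ] ∩ ({2, 6, 8, 18, 19, 22, 23, 24, 26, 31, 32, 34} : Finset (ZMod 35))).card = (SΦ35[Φ, ζ]).card)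
    {ϖ₀ : 𝓞 (maximalRealSubfield K)} (hϖ0 : ϖ₀ ≠ 0) :
    (∃ ζ' : K, IsCMField.complexConj K ζ' = -ζ' ∧ (∀ φ : Φ.1, 0 < (φ.1 ζ').im) ∧
        CMTypeLattice.IsOfType (1 : (FractionalIdeal (𝓞 K)⁰ K)ˣ) ζ' (Ideal.span {ϖ₀})) ↔
      Algebra.norm ℚ ((ϖ₀ : maximalRealSubfield K)) < 0 := by
  have hg : Nat.totient 35 = 2 * (11 + 1) := by decide
  refine exists_type_span_iff_norm_neg_of_odd hζ hg Φ hϖ0 (norm_realUnits_pos_thirtyFive hζ) (exists_units_sign_eq_thirtyFive hζ Φ) ?_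
  have hS := isCMTypeSet_residueFilter hζ Φ
  have hNK : IsCMTypeSet 35 ({2, 6, 8, 18, 19, 22, 23, 24, 26, 31, 32, 34} : Finset (ZMod 35)) := by decide
  have h := card_inter_nodd_mod_two_eq (m := 35) (by norm_num) hS hNK hbal
  have hn : ((({2, 6, 8, 18, 19, 22, 23, 24, 26, 31, 32, 34} : Finset (ZMod 35))).filter fun t : ZMod 35 => 2 * t.val < 35).card % 2 = 1 := by
    decide
  rw [hn] at h
  exact Nat.odd_iff.mpr h

/-- **DICHOTOMY AT LEVEL `35` for EVERY real generator of NEGATIVE norm**: for every one of the `2^24` CM types `Φ` of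
`ℚ(ζ_35)` and every `ϖ₀ ∈ 𝓞 K⁺` with `N_{K⁺/ℚ}(ϖ₀) < 0`, the torus `ℂ^Φ/Φ(ℤ[ζ_35])` carries EITHER an `ι`-compatible
principal polarisation OR a `Φ`-positive divisor of type `(ϖ₀)`, NEVER BOTH (part 55b `xor_principal_span_of_norm_neg` +
THEOREM L (i)/(ii) at `35`; parts 49–54's `exists_principal_xor_type_…` for all their generators at once).
research route conditional on HC_CM; not a corollary; Q11.4-sentence-2 already refuted in dim ≥ 3. [cite: Shimura1998, §14.3 Prop. 4–5, pp. 103–104] -/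
theorem xor_principal_type_thirtyFive_of_norm_neg [IsCMField K] [IsCyclotomicExtension {35} ℚ K] (hζ : IsPrimitiveRoot ζ 35)
    (Φ : CMType K) {ϖ₀ : 𝓞 (maximalRealSubfield K)} (hneg : Algebra.norm ℚ ((ϖ₀ : maximalRealSubfield K)) < 0) :
    Xor (∃ ζ' : K, IsCMField.complexConj K ζ' = -ζ' ∧ (∀ φ : Φ.1, 0 < (φ.1 ζ').im) ∧
          CMTypeLattice.IsOfType (1 : (FractionalIdeal (𝓞 K)⁰ K)ˣ) ζ' ⊤)
      (∃ ζ' : K, IsCMField.complexConj K ζ' = -ζ' ∧ (∀ φ : Φ.1, 0 < (φ.1 ζ').im) ∧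
        CMTypeLattice.IsOfType (1 : (FractionalIdeal (𝓞 K)⁰ K)ˣ) ζ' (Ideal.span {ϖ₀})) := by
  have hg : Nat.totient 35 = 2 * (11 + 1) := by decide
  exact xor_principal_span_of_norm_neg Φ 1 (complexConj_xi hζ hg) (xi_ne_zero hζ 11) (isOfType_one_xi_top hζ 11) hneg
    (norm_realUnits_pos_thirtyFive hζ) (exists_units_sign_eq_thirtyFive hζ Φ)

/-- **POSITIVE norm at level `35`**: for every CM type `Φ` of `ℚ(ζ_35)` and every `ϖ₀ ∈ 𝓞 K⁺` with `N_{K⁺/ℚ}(ϖ₀) > 0`,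
type `(ϖ₀)` occurs on `ℂ^Φ/Φ(ℤ[ζ_35])` iff an `ι`-compatible principal polarisation does (part 55b
`exists_pos_isOfType_span_iff_principal_of_norm_pos` + THEOREM L (i)/(ii) at `35`).
research route conditional on HC_CM; not a corollary; Q11.4-sentence-2 already refuted in dim ≥ 3. [cite: Shimura1998, §14.3 Prop. 4–5, pp. 103–104] -/
theorem exists_type_iff_principal_thirtyFive_of_norm_pos [IsCMField K] [IsCyclotomicExtension {35} ℚ K] (hζ : IsPrimitiveRoot ζ 35)
    (Φ : CMType K) {ϖ₀ : 𝓞 (maximalRealSubfield K)} (hpos : 0 < Algebra.norm ℚ ((ϖ₀ : maximalRealSubfield K))) :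
    (∃ ζ' : K, IsCMField.complexConj K ζ' = -ζ' ∧ (∀ φ : Φ.1, 0 < (φ.1 ζ').im) ∧
        CMTypeLattice.IsOfType (1 : (FractionalIdeal (𝓞 K)⁰ K)ˣ) ζ' (Ideal.span {ϖ₀})) ↔
      (∃ ζ' : K, IsCMField.complexConj K ζ' = -ζ' ∧ (∀ φ : Φ.1, 0 < (φ.1 ζ').im) ∧
          CMTypeLattice.IsOfType (1 : (FractionalIdeal (𝓞 K)⁰ K)ˣ) ζ' ⊤) := by
  have hg : Nat.totient 35 = 2 * (11 + 1) := by decide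
  exact exists_pos_isOfType_span_iff_principal_of_norm_pos Φ 1 (complexConj_xi hζ hg) (xi_ne_zero hζ 11)
    (isOfType_one_xi_top hζ 11) hpos (norm_realUnits_pos_thirtyFive hζ) (exists_units_sign_eq_thirtyFive hζ Φ)

end Level35

/-! ### Level `45` (`g = 24`) -/

section Level45

/-- the residue set `S_Φ` read at level `45`. -/
local notation3 (prettyPrint := false) "SΦ45[" Φ "," z "]" =>
  (Finset.univ.filter fun t : ZMod 45 => ∃ σ ∈ (Φ : CMType K).1, σ (z : K) = 𝐞 t)

open scoped Classical in
/-- **CENSUS ROW `(ℚ(ζ_45), ℚ(√−3))` — THE TYPE SPECTRUM (a NO row: no `ι`-compatible principal polarisation).**  For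
every CM type `Φ` of `ℚ(ζ_45)` balanced for `N_K = [2, 8, 11, 14, 17, 23, 26, 29, 32, 38, 41, 44]` (the Weil signature `(12,12)` on `K = ℚ(√−3)`) and EVERY real integer
`ϖ₀ ∈ 𝓞 K⁺ ∖ 0` (`K⁺ = ℚ(ζ_45)⁺`): the principal CM torus `ℂ^Φ/Φ(ℤ[ζ_45])` carries a `Φ`-positive divisor `X_ζ′` of type
`(K; Φ; (ϖ₀))` — an `ι`-compatible polarisation whose `φ_X` is the `(ϖ₀)𝔬`-multiplication, of degree `|N_{K⁺/ℚ}(ϖ₀)|` —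
**iff `N_{K⁺/ℚ}(ϖ₀) < 0`**.  No sign dictionary for `ϖ₀`: part 55b `exists_type_span_iff_norm_neg_of_odd` + THEOREM L (i)/(ii)
at `45` + `|S_Φ ∩ N_odd| ≡ n₋ = 5` (part 5′ `card_inter_nodd_mod_two_eq`).  The ramified type `𝔮_p` and the surd types of
parts 49–54 are the instances `N(π) = −p^{f}`.
research route conditional on HC_CM; not a corollary; Q11.4-sentence-2 already refuted in dim ≥ 3. [cite: Shimura1998, §14.3 Prop. 4–5, pp. 103–104] -/
theorem exists_type_iff_norm_neg_fortyFive_sqrt_neg_three [IsCMField K] [IsCyclotomicExtension {45} ℚ K] (hζ : IsPrimitiveRoot ζ 45)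
    (Φ : CMType K) (hbal : 2 * (SΦ45[Φ, ζ] ∩ ({2, 8, 11, 14, 17, 23, 26, 29, 32, 38, 41, 44} : Finset (ZMod 45))).card = (SΦ45[Φ, ζ]).card)
    {ϖ₀ : 𝓞 (maximalRealSubfield K)} (hϖ0 : ϖ₀ ≠ 0) :
    (∃ ζ' : K, IsCMField.complexConj K ζ' = -ζ' ∧ (∀ φ : Φ.1, 0 < (φ.1 ζ').im) ∧
        CMTypeLattice.IsOfType (1 : (FractionalIdeal (𝓞 K)⁰ K)ˣ) ζ' (Ideal.span {ϖ₀})) ↔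
      Algebra.norm ℚ ((ϖ₀ : maximalRealSubfield K)) < 0 := by
  have hg : Nat.totient 45 = 2 * (11 + 1) := by decide
  refine exists_type_span_iff_norm_neg_of_odd hζ hg Φ hϖ0 (norm_realUnits_pos_fortyFive hζ) (exists_units_sign_eq_fortyFive hζ Φ) ?_
  have hS := isCMTypeSet_residueFilter hζ Φ
  have hNK : IsCMTypeSet 45 ({2, 8, 11, 14, 17, 23, 26, 29, 32, 38, 41, 44} : Finset (ZMod 45)) := by decide
  have h := card_inter_nodd_mod_two_eq (m := 45) (by norm_num) hS hNK hbal
  have hn : ((({2, 8, 11, 14, 17, 23, 26, 29, 32, 38, 41, 44} : Finset (ZMod 45))).filter fun t : ZMod 45 => 2 * t.val < 45).card % 2 = 1 := by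
    decide
  rw [hn] at h
  exact Nat.odd_iff.mpr h

open scoped Classical in
/-- **CENSUS ROW `(ℚ(ζ_45), ℚ(√−15))` — THE TYPE SPECTRUM (a NO row: no `ι`-compatible principal polarisation).**  For
every CM type `Φ` of `ℚ(ζ_45)` balanced for `N_K = [7, 11, 13, 14, 22, 26, 28, 29, 37, 41, 43, 44]` (the Weil signature `(12,12)` on `K = ℚ(√−15)`) and EVERY real integer
`ϖ₀ ∈ 𝓞 K⁺ ∖ 0` (`K⁺ = ℚ(ζ_45)⁺`): the principal CM torus `ℂ^Φ/Φ(ℤ[ζ_45])` carries a `Φ`-positive divisor `X_ζ′` of type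
`(K; Φ; (ϖ₀))` — an `ι`-compatible polarisation whose `φ_X` is the `(ϖ₀)𝔬`-multiplication, of degree `|N_{K⁺/ℚ}(ϖ₀)|` —
**iff `N_{K⁺/ℚ}(ϖ₀) < 0`**.  No sign dictionary for `ϖ₀`: part 55b `exists_type_span_iff_norm_neg_of_odd` + THEOREM L (i)/(ii)
at `45` + `|S_Φ ∩ N_odd| ≡ n₋ = 5` (part 5′ `card_inter_nodd_mod_two_eq`).  The ramified type `𝔮_p` and the surd types of
parts 49–54 are the instances `N(π) = −p^{f}`.
research route conditional on HC_CM; not a corollary; Q11.4-sentence-2 already refuted in dim ≥ 3. [cite: Shimura1998, §14.3 Prop. 4–5, pp. 103–104] -/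
theorem exists_type_iff_norm_neg_fortyFive_sqrt_neg_fifteen [IsCMField K] [IsCyclotomicExtension {45} ℚ K] (hζ : IsPrimitiveRoot ζ 45)
    (Φ : CMType K) (hbal : 2 * (SΦ45[Φ, ζ] ∩ ({7, 11, 13, 14, 22, 26, 28, 29, 37, 41, 43, 44} : Finset (ZMod 45))).card = (SΦ45[Φ, ζ]).card)
    {ϖ₀ : 𝓞 (maximalRealSubfield K)} (hϖ0 : ϖ₀ ≠ 0) :
    (∃ ζ' : K, IsCMField.complexConj K ζ' = -ζ' ∧ (∀ φ : Φ.1, 0 < (φ.1 ζ').im) ∧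
        CMTypeLattice.IsOfType (1 : (FractionalIdeal (𝓞 K)⁰ K)ˣ) ζ' (Ideal.span {ϖ₀})) ↔
      Algebra.norm ℚ ((ϖ₀ : maximalRealSubfield K)) < 0 := by
  have hg : Nat.totient 45 = 2 * (11 + 1) := by decide
  refine exists_type_span_iff_norm_neg_of_odd hζ hg Φ hϖ0 (norm_realUnits_pos_fortyFive hζ) (exists_units_sign_eq_fortyFive hζ Φ) ?_
  have hS := isCMTypeSet_residueFilter hζ Φ
  have hNK : IsCMTypeSet 45 ({7, 11, 13, 14, 22, 26, 28, 29, 37, 41, 43, 44} : Finset (ZMod 45)) := by decide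
  have h := card_inter_nodd_mod_two_eq (m := 45) (by norm_num) hS hNK hbal
  have hn : ((({7, 11, 13, 14, 22, 26, 28, 29, 37, 41, 43, 44} : Finset (ZMod 45))).filter fun t : ZMod 45 => 2 * t.val < 45).card % 2 = 1 := by
    decide
  rw [hn] at h
  exact Nat.odd_iff.mpr h

/-- **DICHOTOMY AT LEVEL `45` for EVERY real generator of NEGATIVE norm**: for every one of the `2^24` CM types `Φ` of
`ℚ(ζ_45)` and every `ϖ₀ ∈ 𝓞 K⁺` with `N_{K⁺/ℚ}(ϖ₀) < 0`, the torus `ℂ^Φ/Φ(ℤ[ζ_45])` carries EITHER an `ι`-compatible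
principal polarisation OR a `Φ`-positive divisor of type `(ϖ₀)`, NEVER BOTH (part 55b `xor_principal_span_of_norm_neg` +
THEOREM L (i)/(ii) at `45`; parts 49–54's `exists_principal_xor_type_…` for all their generators at once).
research route conditional on HC_CM; not a corollary; Q11.4-sentence-2 already refuted in dim ≥ 3. [cite: Shimura1998, §14.3 Prop. 4–5, pp. 103–104] -/
theorem xor_principal_type_fortyFive_of_norm_neg [IsCMField K] [IsCyclotomicExtension {45} ℚ K] (hζ : IsPrimitiveRoot ζ 45)
    (Φ : CMType K) {ϖ₀ : 𝓞 (maximalRealSubfield K)} (hneg : Algebra.norm ℚ ((ϖ₀ : maximalRealSubfield K)) < 0) :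
    Xor (∃ ζ' : K, IsCMField.complexConj K ζ' = -ζ' ∧ (∀ φ : Φ.1, 0 < (φ.1 ζ').im) ∧
          CMTypeLattice.IsOfType (1 : (FractionalIdeal (𝓞 K)⁰ K)ˣ) ζ' ⊤)
      (∃ ζ' : K, IsCMField.complexConj K ζ' = -ζ' ∧ (∀ φ : Φ.1, 0 < (φ.1 ζ').im) ∧
        CMTypeLattice.IsOfType (1 : (FractionalIdeal (𝓞 K)⁰ K)ˣ) ζ' (Ideal.span {ϖ₀})) := by
  have hg : Nat.totient 45 = 2 * (11 + 1) := by decide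
  exact xor_principal_span_of_norm_neg Φ 1 (complexConj_xi hζ hg) (xi_ne_zero hζ 11) (isOfType_one_xi_top hζ 11) hneg
    (norm_realUnits_pos_fortyFive hζ) (exists_units_sign_eq_fortyFive hζ Φ)

/-- **POSITIVE norm at level `45`**: for every CM type `Φ` of `ℚ(ζ_45)` and every `ϖ₀ ∈ 𝓞 K⁺` with `N_{K⁺/ℚ}(ϖ₀) > 0`,
type `(ϖ₀)` occurs on `ℂ^Φ/Φ(ℤ[ζ_45])` iff an `ι`-compatible principal polarisation does (part 55b
`exists_pos_isOfType_span_iff_principal_of_norm_pos` + THEOREM L (i)/(ii) at `45`).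
research route conditional on HC_CM; not a corollary; Q11.4-sentence-2 already refuted in dim ≥ 3. [cite: Shimura1998, §14.3 Prop. 4–5, pp. 103–104] -/
theorem exists_type_iff_principal_fortyFive_of_norm_pos [IsCMField K] [IsCyclotomicExtension {45} ℚ K] (hζ : IsPrimitiveRoot ζ 45)
    (Φ : CMType K) {ϖ₀ : 𝓞 (maximalRealSubfield K)} (hpos : 0 < Algebra.norm ℚ ((ϖ₀ : maximalRealSubfield K))) :
    (∃ ζ' : K, IsCMField.complexConj K ζ' = -ζ' ∧ (∀ φ : Φ.1, 0 < (φ.1 ζ').im) ∧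
        CMTypeLattice.IsOfType (1 : (FractionalIdeal (𝓞 K)⁰ K)ˣ) ζ' (Ideal.span {ϖ₀})) ↔
      (∃ ζ' : K, IsCMField.complexConj K ζ' = -ζ' ∧ (∀ φ : Φ.1, 0 < (φ.1 ζ').im) ∧
          CMTypeLattice.IsOfType (1 : (FractionalIdeal (𝓞 K)⁰ K)ˣ) ζ' ⊤) := by
  have hg : Nat.totient 45 = 2 * (11 + 1) := by decide
  exact exists_pos_isOfType_span_iff_principal_of_norm_pos Φ 1 (complexConj_xi hζ hg) (xi_ne_zero hζ 11)
    (isOfType_one_xi_top hζ 11) hpos (norm_realUnits_pos_fortyFive hζ) (exists_units_sign_eq_fortyFive hζ Φ)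

end Level45

end Summit.HodgeConjecture.Ring2WeilCoverage.TypeNormSignLevelsG12

end
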